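import Summits.CriticalPhenomena.PercolationContinuityZ3.Theorems.PercNearOneGluingNoHeavyLowerTailQuantitativeCshWorldFloorClosure
import Summits.CriticalPhenomena.PercolationContinuityZ3.Theorems.PercNearOneGluingNoHeavyLowerTailQuantitativeHarrisInfluenceFloor
import Summits.CriticalPhenomena.PercolationContinuityZ3.Theorems.PercNearOneGluingNoHeavyLowerTailQuantitativeBHKStrict
import HarnessLib

/-!
# An explicit, size-free and COMPLETE floor for the margin of CSH(Y; x; []; o, v): the `Y`-isolated world

Support file (`--supports stmt-CriticalPhenomena-4575`), prover seat `prim-rate-mine-2` (lane prim-rate, constants-miner (c), BENCH row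
M2-R20; `run/shared/lean/prim/prim-rate/prim-rate-mine-2/CANDIDATES.md` §gen-4).  No definitions, no named facts, no sorries; standard axioms.

The world-Harris floor of the level-`[]` CSH margin (`CSH.cshMargin_nil_ge_worldHarris_of_lt_one`, row M2-R7 closed over degenerate weights) is an
average over the worlds `ω` of residual Harris covariances.  Every term is nonnegative, and on the event `Z = {all pairs meeting Y are closed}`
(probability `∏_{e ∩ Y ≠ ∅} (1 − w_e)`, contained in `D₀ = {x ↮ Y}`) the residual weights are the FIXED weights `w_Y` = `w` zeroed on the pairs
meeting `Y`.  Hence, for every weight function with all `w e < 1`, `x ∉ Y`, `o, v ∉ {x} ∪ Y`, `o ≠ v`, `f` monotone nonnegative, `U = {o↔x} ∪ {o↔v}`: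

  `μ(D₀) · ∏_{e ∩ Y ≠ ∅} (1 − w_e) · Cov_{w_Y}(f(𝒞_x), 1_U) ≤ cshMargin w x Y [] o v f`   (`CSH.cshMargin_nil_ge_isolated_harris`),

and, bounding the `w_Y`-covariance by the influence-product floor of row M2-R17, for every pair `e`

  `μ(D₀) · ∏_{e' ∩ Y ≠ ∅} (1 − w_{e'}) · w_e(1−w_e) · (∫ Δ_e f(𝒞_x) dμ_{w_Y}) · μ_{w_Y}{e pivotal for U} ≤ cshMargin w x Y [] o v f`

(`CSH.cshMargin_nil_ge_isolated_influenceFloor`).  For connection functionals and non-degenerate weights this floor is COMPLETE: it is positive for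
some `e` exactly on the equality locus criterion of row M2-R19 (`QuantHarris.cov_pos_iff_exists_pivotal` in the graph `E ∖ pairs(Y)`).  No `|E|`.
[cite: VandenbergHaggstromKahn2005, §2.1 (pp. 9–13)] [cite: Harris1960, Lemma 4.1 (p. 16)] [cite: Grimmett1999, §7.3 p. 162]
-/

noncomputable section

namespace Summit.CriticalPhenomena.PercolationContinuityZ3.Theorems

open MeasureTheory Set Literature.Probability.LatticeModels Literature.Probability.Percolation
open Literature.Probability.Percolation.BHK2006 (openEdgeCluster_mono)
open scoped Classical

namespace CSH

variable {V : Type*} [Fintype V]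

/-- **The `Y`-isolated floor of CSH(Y; x; []; o, v).**  All `w e < 1`; `x ∉ Y`; `o, v ∉ {x} ∪ Y`; `o ≠ v`; `f` monotone nonnegative;
`w_Y` = `w` zeroed on the pairs meeting `Y`, `U = {o↔x} ∪ {o↔v}`, `D₀ = {x↮Y}`:
`μ(D₀) · (∏_{e ∩ Y ≠ ∅} (1 − w_e)) · (∫_U f(𝒞_x) dμ_{w_Y} − μ_{w_Y}(U)·∫ f(𝒞_x) dμ_{w_Y}) ≤ cshMargin w x Y [] o v f`.  BENCH row M2-R20.
[cite: VandenbergHaggstromKahn2005, §2.1 (pp. 9–13)] [cite: Harris1960, Lemma 4.1 (p. 16)] -/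
theorem cshMargin_nil_ge_isolated_harris (w : Sym2 V → unitInterval) (hw : ∀ e, w e < 1) (x : V) (Y : Set V) (o v : V)
    (hxY : x ∉ Y) (hox : o ≠ x) (hvx : v ≠ x) (hoY : o ∉ Y) (hvY : v ∉ Y) (hov : o ≠ v)
    (f : Set (Sym2 V) → ℝ) (hf : Monotone f) (hf0 : ∀ C, 0 ≤ f C) :
    (prodBernoulli w).real {ω : BondConfig V | ∀ y ∈ Y, ¬ (openGraph ω).Reachable x y} *
        ((∏ e ∈ Finset.univ.filter (fun e : Sym2 V => ∃ y ∈ Y, y ∈ e), (1 - (w e : ℝ))) *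
          ((∫ η in ((⋃ t ∈ ({x} : Finset V), openConn o t) ∪ openConn o v), f (openEdgeCluster η x)
              ∂(prodBernoulli fun e => if (∃ y ∈ Y, y ∈ e) then (0 : unitInterval) else w e)) -
            (prodBernoulli fun e => if (∃ y ∈ Y, y ∈ e) then (0 : unitInterval) else w e).real
                ((⋃ t ∈ ({x} : Finset V), openConn o t) ∪ openConn o v) *
              (∫ η, f (openEdgeCluster η x) ∂(prodBernoulli fun e => if (∃ y ∈ Y, y ∈ e) then (0 : unitInterval) else w e)))) ≤
      cshMargin w x Y [] o v f := by
  set μ := prodBernoulli w with hμ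
  set D₀ : Set (BondConfig V) := {ω : BondConfig V | ∀ y ∈ Y, ¬ (openGraph ω).Reachable x y} with hD₀
  set U : Set (BondConfig V) := (⋃ t ∈ ({x} : Finset V), openConn o t) ∪ openConn o v with hU
  have hmeas : ∀ S : Set (BondConfig V), MeasurableSet S := fun _ => MeasurableSet.of_discrete
  set q : BondConfig V → (Sym2 V → unitInterval) := fun ω e =>
    if (∃ z ∈ e, ∃ y ∈ Y, (openGraph ω).Reachable y z) then (0 : unitInterval) else w e with hq
  set qY : Sym2 V → unitInterval := fun e => if (∃ y ∈ Y, y ∈ e) then (0 : unitInterval) else w e with hqY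
  set H : BondConfig V → ℝ := fun ω =>
    (∫ η in U, f (openEdgeCluster η x) ∂(prodBernoulli (q ω))) -
      (prodBernoulli (q ω)).real U * ∫ η, f (openEdgeCluster η x) ∂(prodBernoulli (q ω)) with hH
  set HY : ℝ := (∫ η in U, f (openEdgeCluster η x) ∂(prodBernoulli qY)) -
      (prodBernoulli qY).real U * ∫ η, f (openEdgeCluster η x) ∂(prodBernoulli qY) with hHY
  have hfloor : μ.real D₀ * ∫ ω in D₀, H ω ∂μ ≤ cshMargin w x Y [] o v f :=
    cshMargin_nil_ge_worldHarris_of_lt_one w hw x Y o v hxY hox hvx hoY hvY hov f hf hf0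
  -- the Harris term of a product measure is nonnegative
  have hUup : ∀ ω ω' : BondConfig V, ω ⊆ ω' → ω ∈ U → ω' ∈ U := by
    rintro ω ω' hle (h | h)
    · obtain ⟨t, ht, h⟩ := Set.mem_iUnion₂.1 h
      exact Or.inl (Set.mem_iUnion₂.2 ⟨t, ht, SimpleGraph.Reachable.mono (BHK2006.openGraph_le hle) h⟩)
    · exact Or.inr (SimpleGraph.Reachable.mono (BHK2006.openGraph_le hle) h)
  have hharris : ∀ p : Sym2 V → unitInterval, 0 ≤ (∫ η in U, f (openEdgeCluster η x) ∂(prodBernoulli p)) -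
      (prodBernoulli p).real U * ∫ η, f (openEdgeCluster η x) ∂(prodBernoulli p) := by
    intro p
    have h := QuantHarris.influence_mul_influence_le_cov_prodBernoulli p (s(x, x)) (fun η => f (openEdgeCluster η x))
      (U.indicator fun _ => (1 : ℝ)) (fun _ => hf0 _) (fun ω => indicator_nonneg (fun _ _ => zero_le_one) ω)
      (fun _ _ h => hf (openEdgeCluster_mono h x)) (QuantHarris.indicator_upset_monotone hUup)
    have hprod : (fun η => f (openEdgeCluster η x) * U.indicator (fun _ => (1 : ℝ)) η) = U.indicator (fun η => f (openEdgeCluster η x)) := by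
      funext η
      by_cases hη : η ∈ U
      · rw [indicator_of_mem hη, indicator_of_mem hη, mul_one]
      · rw [indicator_of_notMem hη, indicator_of_notMem hη, mul_zero]
    rw [hprod, integral_indicator (hmeas U), integral_indicator (hmeas U)] at h
    simp only [integral_const, smul_eq_mul, mul_one, measureReal_restrict_apply_univ] at h
    simp only [QuantHarris.indicator_insert_sub_indicator_diff hUup] at h
    have h0 : 0 ≤ (p s(x, x) : ℝ) * (1 - p s(x, x)) *
        ((∫ η, (f (openEdgeCluster (insert s(x, x) η) x) - f (openEdgeCluster (η \ {s(x, x)}) x)) ∂(prodBernoulli p)) *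
          ∫ η, ({ω : Set (Sym2 V) | insert s(x, x) ω ∈ U ∧ ω \ {s(x, x)} ∉ U}).indicator (fun _ => (1 : ℝ)) η ∂(prodBernoulli p)) := by
      refine mul_nonneg (mul_nonneg (p _).2.1 (sub_nonneg.2 (p _).2.2)) (mul_nonneg ?_ ?_)
      · exact integral_nonneg fun η => sub_nonneg.2 (hf (openEdgeCluster_mono (Set.sdiff_subset.trans (Set.subset_insert _ η)) x))
      · exact integral_nonneg fun η => indicator_nonneg (fun _ _ => zero_le_one) η
    rw [mul_comm ((prodBernoulli p).real U)]
    linarith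
  have hH0 : ∀ ω, 0 ≤ H ω := fun ω => hharris (q ω)
  -- the `Y`-isolated event
  set PY : Finset (Sym2 V) := Finset.univ.filter (fun e : Sym2 V => ∃ y ∈ Y, y ∈ e) with hPY
  set Z : Set (BondConfig V) := {ω : BondConfig V | ∀ e ∈ PY, e ∉ ω} with hZ
  have hZμ : μ.real Z = ∏ e ∈ PY, (1 - (w e : ℝ)) := prodBernoulli_real_forall_notMem w PY
  have hZD : Z ⊆ D₀ := by
    intro ω hω y hy h
    have hyiso : ∀ e ∈ ω, y ∉ e := fun e he hye => hω e (by rw [hPY, Finset.mem_filter]; exact ⟨Finset.mem_univ e, y, hy, hye⟩) he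
    exact hxY ((QuantBHK.eq_of_reachable_of_forall_notMem hyiso h.symm) ▸ hy)
  -- on `Z` the residual weights are `qY`
  have hqZ : ∀ ω ∈ Z, q ω = qY := by
    intro ω hω
    funext e
    have hiff : (∃ z ∈ e, ∃ y ∈ Y, (openGraph ω).Reachable y z) ↔ (∃ y ∈ Y, y ∈ e) := by
      constructor
      · rintro ⟨z, hz, y, hy, hyz⟩
        have hyiso : ∀ e ∈ ω, y ∉ e := fun e he hye => hω e (by rw [hPY, Finset.mem_filter]; exact ⟨Finset.mem_univ e, y, hy, hye⟩) he
        have hzy : z = y := QuantBHK.eq_of_reachable_of_forall_notMem hyiso hyz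
        exact ⟨y, hy, hzy ▸ hz⟩
      · rintro ⟨y, hy, hye⟩
        exact ⟨y, hye, y, hy, SimpleGraph.Reachable.refl y⟩
    simp only [hq, hqY]
    by_cases hc : ∃ y ∈ Y, y ∈ e
    · rw [if_pos (hiff.2 hc), if_pos hc]
    · rw [if_neg (fun h => hc (hiff.1 h)), if_neg hc]
  have hHZ : ∀ ω ∈ Z, H ω = HY := by
    intro ω hω
    simp only [hH, hHY, hqZ ω hω]
  -- `∫_{D₀} H ≥ ∫_Z H = μ(Z) · HY`
  have hint : μ.real Z * HY ≤ ∫ ω in D₀, H ω ∂μ := by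
    have h1 : ∫ ω in Z, H ω ∂μ ≤ ∫ ω in D₀, H ω ∂μ :=
      setIntegral_mono_set (Integrable.of_finite).integrableOn (Filter.Eventually.of_forall fun ω => hH0 ω)
        (Filter.Eventually.of_forall hZD)
    have h2 : ∫ ω in Z, H ω ∂μ = ∫ ω in Z, HY ∂μ := setIntegral_congr_fun (hmeas Z) fun ω hω => hHZ ω hω
    rw [h2, setIntegral_const, smul_eq_mul, measureReal_def] at h1
    rw [measureReal_def]
    exact h1
  have hD0 : 0 ≤ μ.real D₀ := measureReal_nonneg
  have h3 := mul_le_mul_of_nonneg_left hint hD0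
  rw [hZμ] at h3
  linarith [hfloor, h3]

/-- **The `Y`-isolated influence-product floor of CSH(Y; x; []; o, v)** (size-free, explicit): with the notation of
`cshMargin_nil_ge_isolated_harris` and every pair `e`,
`μ(D₀) · ∏_{e' ∩ Y ≠ ∅} (1 − w_{e'}) · w_Y(e)(1 − w_Y(e)) · (∫ (f(𝒞_x(η ∪ e)) − f(𝒞_x(η ∖ e))) dμ_{w_Y}) · μ_{w_Y}{η : η ∪ e ∈ U, η ∖ e ∉ U}`
`≤ cshMargin w x Y [] o v f`.  For connection functionals and non-degenerate weights this floor is positive for some `e` exactly on the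
equality-locus criterion of row M2-R19.  BENCH row M2-R20. [cite: VandenbergHaggstromKahn2005, §2.1 (pp. 9–13)] [cite: Harris1960, Lemma 4.1 (p. 16)] -/
theorem cshMargin_nil_ge_isolated_influenceFloor (w : Sym2 V → unitInterval) (hw : ∀ e, w e < 1) (x : V) (Y : Set V) (o v : V)
    (hxY : x ∉ Y) (hox : o ≠ x) (hvx : v ≠ x) (hoY : o ∉ Y) (hvY : v ∉ Y) (hov : o ≠ v)
    (f : Set (Sym2 V) → ℝ) (hf : Monotone f) (hf0 : ∀ C, 0 ≤ f C) (e : Sym2 V) :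
    (prodBernoulli w).real {ω : BondConfig V | ∀ y ∈ Y, ¬ (openGraph ω).Reachable x y} *
        ((∏ e' ∈ Finset.univ.filter (fun e' : Sym2 V => ∃ y ∈ Y, y ∈ e'), (1 - (w e' : ℝ))) *
          ((((fun e' => if (∃ y ∈ Y, y ∈ e') then (0 : unitInterval) else w e') e : unitInterval) : ℝ) *
              (1 - (((fun e' => if (∃ y ∈ Y, y ∈ e') then (0 : unitInterval) else w e') e : unitInterval) : ℝ)) *
            ((∫ η, (f (openEdgeCluster (insert e η) x) - f (openEdgeCluster (η \ {e}) x))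
                ∂(prodBernoulli fun e' => if (∃ y ∈ Y, y ∈ e') then (0 : unitInterval) else w e')) *
              (prodBernoulli fun e' => if (∃ y ∈ Y, y ∈ e') then (0 : unitInterval) else w e').real
                {η : BondConfig V | insert e η ∈ (((⋃ t ∈ ({x} : Finset V), openConn o t) ∪ openConn o v : Set (BondConfig V))) ∧
                  η \ {e} ∉ (((⋃ t ∈ ({x} : Finset V), openConn o t) ∪ openConn o v : Set (BondConfig V)))}))) ≤
      cshMargin w x Y [] o v f := by
  set U : Set (BondConfig V) := (⋃ t ∈ ({x} : Finset V), openConn o t) ∪ openConn o v with hU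
  set qY : Sym2 V → unitInterval := fun e' => if (∃ y ∈ Y, y ∈ e') then (0 : unitInterval) else w e' with hqY
  have hmeas : ∀ S : Set (BondConfig V), MeasurableSet S := fun _ => MeasurableSet.of_discrete
  have hbase := cshMargin_nil_ge_isolated_harris w hw x Y o v hxY hox hvx hoY hvY hov f hf hf0
  have hUup : ∀ ω ω' : BondConfig V, ω ⊆ ω' → ω ∈ U → ω' ∈ U := by
    rintro ω ω' hle (h | h)
    · obtain ⟨t, ht, h⟩ := Set.mem_iUnion₂.1 h
      exact Or.inl (Set.mem_iUnion₂.2 ⟨t, ht, SimpleGraph.Reachable.mono (BHK2006.openGraph_le hle) h⟩)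
    · exact Or.inr (SimpleGraph.Reachable.mono (BHK2006.openGraph_le hle) h)
  have h := QuantHarris.influence_mul_influence_le_cov_prodBernoulli qY e (fun η => f (openEdgeCluster η x))
    (U.indicator fun _ => (1 : ℝ)) (fun _ => hf0 _) (fun ω => indicator_nonneg (fun _ _ => zero_le_one) ω)
    (fun _ _ h => hf (openEdgeCluster_mono h x)) (QuantHarris.indicator_upset_monotone hUup)
  simp only [QuantHarris.indicator_insert_sub_indicator_diff hUup] at h
  have hprod : (fun η => f (openEdgeCluster η x) * U.indicator (fun _ => (1 : ℝ)) η) = U.indicator (fun η => f (openEdgeCluster η x)) := by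
    funext η
    by_cases hη : η ∈ U
    · rw [indicator_of_mem hη, indicator_of_mem hη, mul_one]
    · rw [indicator_of_notMem hη, indicator_of_notMem hη, mul_zero]
  rw [hprod, integral_indicator (hmeas U), integral_indicator (hmeas _), integral_indicator (hmeas _)] at h
  simp only [integral_const, smul_eq_mul, mul_one, measureReal_restrict_apply_univ] at h
  -- multiply the M2-R17 floor by the nonnegative prefactors and chain with the `Y`-isolated floor
  rw [mul_comm (∫ η, f (openEdgeCluster η x) ∂(prodBernoulli qY)) ((prodBernoulli qY).real U)] at h
  have hbase' : (prodBernoulli w).real {ω : BondConfig V | ∀ y ∈ Y, ¬ (openGraph ω).Reachable x y} *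
      ((∏ e' ∈ Finset.univ.filter (fun e' : Sym2 V => ∃ y ∈ Y, y ∈ e'), (1 - (w e' : ℝ))) *
        ((∫ η in U, f (openEdgeCluster η x) ∂(prodBernoulli qY)) -
          (prodBernoulli qY).real U * ∫ η, f (openEdgeCluster η x) ∂(prodBernoulli qY))) ≤ cshMargin w x Y [] o v f := hbase
  have hP0 : 0 ≤ ∏ e' ∈ Finset.univ.filter (fun e' : Sym2 V => ∃ y ∈ Y, y ∈ e'), (1 - (w e' : ℝ)) :=
    Finset.prod_nonneg fun e' _ => sub_nonneg.2 (w e').2.2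
  have hA0 : 0 ≤ (prodBernoulli w).real {ω : BondConfig V | ∀ y ∈ Y, ¬ (openGraph ω).Reachable x y} := measureReal_nonneg
  exact le_trans (mul_le_mul_of_nonneg_left (mul_le_mul_of_nonneg_left h hP0) hA0) hbase'

end CSH

end Summit.CriticalPhenomena.PercolationContinuityZ3.Theorems
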